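/-
# Cor 3.8 WITH DECAYING block letters, and Theorem 3.10 at one scale in PRINT'S bookkeeping FROM THEOREM 3.7's INPUTS

Cell `pub-balaban-gaps`, seat **g1-p2 GEN 5** (prover), row **(D4)**.  Junction J44-2 ∕ plan-1 note 28 (the (U)∕(F)
dictionary, L-13): file 44 (`D4WalkBlockOneScalePrint.blockWalkExpansion_oneScale_print`) consumes the DECAYING block letters
`IsDomainLocalBD` (file 43) of the seed family `□ ↦ h_□G′_□(u)h_□` and of the step family `□ ↦ K(h_□)(u)G′_□(u)h_□`
THEMSELVES.  This file DERIVES both letters from PRIMITIVE letters ON `Δ′` — exactly as file 33 (`D4WalkBlockParametrix`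
§4) did for the flat letters consumed by file 40 —:
* the local inverses `G′_□(u)`: block bound `‖G′_□(u)‖_{y,y′} ≤ C_L·e^{−ρ₀d₁(y,y′)}` on the `R`-ball (print's (3.42) ∕
  Combes–Thomas decay of the Dirichlet local inverse, the `C_L = c_s∕m` of file 36 with its rate), holomorphic entries;
* the commutators `K(h_□)(u) = h_□K′(u) − K′(u)h_□`: block bound `‖K(h_□)(u)‖_{y,y″} ≤ λ_K·e^{−ρ₀d₁(y,y″)}`, blocks inside
  `dom □ × dom □` (print: `K(h_□) = O(M⁻¹)` localized near `supp ∇h_□`; a finite-range `K′` of cube range `r_K` with the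
  flat Lipschitz letter `λ_K = (r₁∕M)C_K` of file 35 has this letter with `λ_Ke^{ρ₀r_K}`);
* the partition `{h_□}`: `|h_□| ≤ 1`, `supp h_□ ⊂ dom □`;
⟹ `λ_S = C_L`, `λ_R = n_C·λ_K·C_L` AT THE SAME RATE `ρ₀` (the triangle inequality absorbs the middle cube: NO `e^{2ρ₀r}`),
families untagged (`J ≡ ∅`, `X = ∅`: print routes the σ-dependence ONCE per walk, file 42).  §3 composes BY NAME with file 44:
Theorem 3.10 at one scale with print's POWER-ONE s-decoration, margin `q = c_μ⁵·n_Cλ_KC_L·e^{μr}·n_D` — `O(λ_K) = O(M⁻¹)`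
at fixed cube geometry, NEITHER `e^{κ₁m_J}` NOR `e^{2ρ₀r}` —, and at `s ≡ 1` the decorated kernel IS `Δ′(u)⁻¹ = (1 + K′(u))⁻¹`
((3.88) discharged by the prior engine's resummation identity, file 33 §3).
HONEST FRAMING: packaging at MODEL generality (any domain skeleton on a torus of cubes; the letters are HYPOTHESES on `Δ′`'s
local inverses and commutators); Bałaban's `Δ^{(k)}(𝐔)` ∕ `G̃₀` NOT touched, k-uniformity NOT addressed; (D4) instance 0∕1;
NOT continuum, NOT Clay.

References: T. Bałaban, Comm. Math. Phys. 99 (1985) 389–434 [B9], Thm 3.7 (3.87)–(3.90) p.409, Cor 3.8 (3.91)–(3.94) p.410,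
Thm 3.10 (3.107)–(3.108) p.416, (3.42) p.399; Comm. Math. Phys. 116 (1988) 1–22 [II], p.3, (1.11) p.5, p.13, p.15, (2.16) p.16;
Comm. Math. Phys. 96 (1984) 223–250, (2.54) p.233, (2.61) p.234.
-/
import Summits.QuantumFields.BalabanUV.Gaps.D4WalkBlockOneScalePrint
import Summits.QuantumFields.BalabanUV.Gaps.D4WalkBlockParametrix

noncomputable section

namespace Summit.QuantumFields.BalabanUV.Gaps.D4WalkBlockParametrixDecay

open Metric Set Finset
open Literature.MathematicalPhysics.QuantumFieldTheory.Balaban1983to89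
open Literature.MathematicalPhysics.QuantumFieldTheory.Balaban1983to89.B9SectDWalk (DomBy)
open Literature.MathematicalPhysics.QuantumFieldTheory.Balaban1983to89.B9Thm34Ext (toB6)
open Literature.MathematicalPhysics.QuantumFieldTheory.Balaban1983to89.B9Thm37GlueTorus
  (torusGeom tdist1 tdist1_nonneg tdist1_triangle tdist1_self)
open Literature.MathematicalPhysics.QuantumFieldTheory.Balaban1983to89.TreeLengthTorus (TPt)
open Literature.MathematicalPhysics.QuantumFieldTheory.Balaban1983to89.B5TorusCover (UT)
open Literature.MathematicalPhysics.QuantumFieldTheory.Balaban1983to89.B11SectG (RowSum)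
open Literature.MathematicalPhysics.QuantumFieldTheory.Balaban1983to89.B13DomainKernelWalks (DomainTerms)
open Summit.QuantumFields.BalabanUV.Gaps.D4WalkBlock (blockNorm blockNorm_nonneg blockNorm_mul_le BlockWalkExpansion)
open Summit.QuantumFields.BalabanUV.Gaps.D4WalkBlockParametrix
  (blockNorm_mul_diagonal_le blockNorm_diagonal_mul_le blockNorm_mul_diagonal_eq_zero blockNorm_diagonal_mul_eq_zero
    blockNorm_mul_eq_zero_of_left differentiableOn_mul_apply glued_one_eq_inv)
open Summit.QuantumFields.BalabanUV.Gaps.D4WalkBlockLocalDecay (IsDomainLocalBD)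
open Summit.QuantumFields.BalabanUV.Gaps.D4WalkBlockDecorate (decTerm decKernel)
open Summit.QuantumFields.BalabanUV.Gaps.D4WalkBlockOneScalePrint (blockWalkExpansion_oneScale_print)
open Summit.QuantumFields.BalabanUV.T4Continuum.Spine.NE5.TwoRunPencilDomains (withOp)
open Summit.QuantumFields.BalabanUV.Beta.UnitLatticeWalkInversion (Hd Pj)

variable {d N' : ℕ} {ν : ℕ} {K : Fin ν → ℕ} [∀ i, NeZero (K i)]
variable {n : Type} [Fintype n] [DecidableEq n]
variable {E : Type*} [NormedAddCommGroup E] [NormedSpace ℂ E]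
variable {L : DomainTerms d N' ν K n n E} {h : L.B → n → ℝ} {Es : L.B → Finset n} {K' : E → Matrix n n ℂ}
variable {c₀ c : B13.Consts} {cubn : n → UT K} {X : Finset (UT K)} {R CL lamK r : ℝ} {nD nC : ℕ}
variable {ρ₀ ε₀ κ₀ μ cμ : ℝ}

/-! ## §1. Elementary: partition entries, the one-point distance of an untagged term -/

omit [Fintype n] [DecidableEq n] in
/-- The complex entries of a partition function with `|h| ≤ 1` have norm `≤ 1`. [folklore] -/
private theorem norm_h_le (habs : ∀ b y, |h b y| ≤ 1) (b : L.B) (y : n) : ‖((h b y : ℝ) : ℂ)‖ ≤ 1 := by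
  rw [Complex.norm_real, Real.norm_eq_abs]; exact habs b y

omit [Fintype n] [DecidableEq n] in
/-- Off its support a partition function's complex entry vanishes. [folklore] -/
private theorem h_eq_zero (hsupp : ∀ b y, y ∉ Es b → h b y = 0) (hE : ∀ b y, y ∈ Es b → cubn y ∈ L.dom b)
    (b : L.B) {y' : UT K} (hy' : y' ∉ L.dom b) (j : n) (hj : cubn j = y') : ((h b j : ℝ) : ℂ) = 0 := by
  have : j ∉ Es b := fun hj' => hy' (hj ▸ hE b j hj')
  rw [hsupp b j this, Complex.ofReal_zero]

omit [Fintype n] [DecidableEq n] in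
/-- With no σ-region (`X = ∅`) the one-point distance of a term passes through its whole domain, so from a cube OF the domain
it is below the torus distance: `D_□(y,y′) ≤ d₁(y,y′)` for `y ∈ dom □`. [cite: Balaban1985BackgroundPropagators, (3.93) p.410] -/
theorem dist_empty_le_tdist1 (L' : DomainTerms d N' ν K n n E) (b : L'.B) {y : UT K} (hy : y ∈ L'.dom b) (y' : UT K) :
    L'.dist ∅ b y y' ≤ tdist1 K y y' := by
  have hvia : L'.via ∅ b = L'.dom b := by
    unfold DomainTerms.via
    rw [if_neg (by simp)]
  have h1 := L'.dist_le ∅ b (z := y) (by rw [hvia]; exact hy) y y'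
  rwa [tdist1_self, zero_add] at h1

omit [Fintype n] [DecidableEq n] in
/-- Hence a letter decaying in `d₁` from a cube of the domain decays in the one-point distance (`ρ ≥ 0`, `a ≥ 0`).
[cite: Balaban1985BackgroundPropagators, (3.93) p.410] -/
theorem mul_exp_tdist1_le_dist (L' : DomainTerms d N' ν K n n E) (b : L'.B) {y : UT K} (hy : y ∈ L'.dom b) (y' : UT K)
    {a ρ : ℝ} (ha : 0 ≤ a) (hρ : 0 ≤ ρ) :
    a * Real.exp (-(ρ * tdist1 K y y')) ≤ a * Real.exp (-(ρ * L'.dist ∅ b y y')) :=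
  mul_le_mul_of_nonneg_left (Real.exp_le_exp.2 (by
    have := dist_empty_le_tdist1 L' b hy y'
    nlinarith)) ha

/-! ## §2. Cor 3.8 as a lemma, DECAYING block letters: `λ_S = C_L`, `λ_R = n_Cλ_KC_L`, both at the rate `ρ₀` of `G′_□` -/

/-- **THE SEED FAMILY `□ ↦ h_□G′_□(u)h_□` HAS THE DECAYING BLOCK LETTER `(C_L, ρ₀)`** (the (3.87) half of Cor 3.8 with
(3.42)'s decay kept): diagonal factors `|h_□| ≤ 1` do not increase block norms, blocks lie in the cubes of `supp h_□ ⊂ dom □`,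
and from a cube of the domain `e^{−ρ₀d₁} ≤ e^{−ρ₀D_□}` (§1); untagged (`J ≡ ∅`, `X = ∅`).
[cite: Balaban1985BackgroundPropagators, (3.42) p.399, (3.87) p.409, Cor 3.8 (3.91)–(3.94) p.410] -/
theorem isDomainLocalBD_seed
    (hanchor : ∀ b, L.anchor b ∈ L.dom b) (hdiam : ∀ b, ∀ z ∈ L.dom b, ∀ z' ∈ L.dom b, tdist1 K z z' ≤ r)
    (hJ0 : ∀ b, L.J b = ∅) (hmult : ∀ z : UT K, (Finset.univ.filter fun b => L.anchor b = z).card ≤ nD)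
    (hsupp : ∀ b y, y ∉ Es b → h b y = 0) (habs : ∀ b y, |h b y| ≤ 1) (hE : ∀ b y, y ∈ Es b → cubn y ∈ L.dom b)
    (hLan : ∀ b i j, DifferentiableOn ℂ (fun u => L.op b u i j) (ball (0 : E) R))
    (hLbdD : ∀ b, ∀ u ∈ ball (0 : E) R, ∀ y y',
      blockNorm cubn cubn (L.op b u) y y' ≤ CL * Real.exp (-(ρ₀ * tdist1 K y y')))
    (hCL : 0 ≤ CL) (hρ₀ : 0 ≤ ρ₀) :
    IsDomainLocalBD (withOp L fun b u => Hd h b * L.op b u * Hd h b) c₀ cubn cubn ∅ R CL ρ₀ r 0 nD := by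
  -- support of the sandwich: both cubes in the domain
  have hsuppB : ∀ b u y y', blockNorm cubn cubn (Hd h b * L.op b u * Hd h b) y y' ≠ 0 → y ∈ L.dom b ∧ y' ∈ L.dom b := by
    intro b u y y' hne
    refine ⟨?_, ?_⟩
    · by_contra hy
      apply hne
      rw [Matrix.mul_assoc]
      exact blockNorm_diagonal_mul_eq_zero cubn cubn (L.op b u * Hd h b) y y' (fun i hi => h_eq_zero hsupp hE b hy i hi)
    · by_contra hy'
      apply hne
      exact blockNorm_mul_diagonal_eq_zero cubn cubn (Hd h b * L.op b u) y y' (fun j hj => h_eq_zero hsupp hE b hy' j hj)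
  exact
  { hanchor := hanchor
    hsuppB := hsuppB
    han := fun b i j => by
      change DifferentiableOn ℂ (fun u => (Hd h b * L.op b u * Hd h b) i j) (ball (0 : E) R)
      simp only [Hd, Matrix.mul_diagonal, Matrix.diagonal_mul]
      exact ((differentiableOn_const _).mul (hLan b i j)).mul (differentiableOn_const _)
    hbdBD := fun b u hu y y' => by
      change blockNorm cubn cubn (Hd h b * L.op b u * Hd h b) y y' ≤
        CL * Real.exp (-(ρ₀ * (withOp L fun b u => Hd h b * L.op b u * Hd h b).dist ∅ b y y'))
      by_cases h0 : blockNorm cubn cubn (Hd h b * L.op b u * Hd h b) y y' = 0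
      · rw [h0]; positivity
      have hy : y ∈ L.dom b := (hsuppB b u y y' h0).1
      calc blockNorm cubn cubn (Hd h b * L.op b u * Hd h b) y y' ≤ blockNorm cubn cubn (Hd h b * L.op b u) y y' :=
            blockNorm_mul_diagonal_le cubn cubn _ (norm_h_le habs b) y y'
        _ ≤ blockNorm cubn cubn (L.op b u) y y' := blockNorm_diagonal_mul_le cubn cubn _ (norm_h_le habs b) y y'
        _ ≤ CL * Real.exp (-(ρ₀ * tdist1 K y y')) := hLbdD b u hu y y'
        _ ≤ _ := mul_exp_tdist1_le_dist (withOp L fun b u => Hd h b * L.op b u * Hd h b) b hy y' hCL hρ₀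
    hdiam := hdiam
    hJ := fun b => by change (L.J b).card ≤ 0; rw [hJ0 b, Finset.card_empty]
    hX := fun b hb => by
      exfalso
      have h1 : (L.J b).Nonempty := hb
      rw [hJ0 b] at h1
      exact Finset.not_nonempty_empty h1
    hmult := hmult }

/-- **THE STEP FAMILY `□ ↦ K(h_□)(u)G′_□(u)h_□` HAS THE DECAYING BLOCK LETTER `(n_Cλ_KC_L, ρ₀)`** (the (3.89) half of Cor 3.8
with the decay kept): `‖K(h_□)G′_□h_□‖_{y,y′} ≤ Σ_{y″ ∈ dom □} λ_Ke^{−ρ₀d₁(y,y″)}·C_Le^{−ρ₀d₁(y″,y′)} ≤ n_Cλ_KC_L·e^{−ρ₀d₁(y,y′)}`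
by the triangle inequality — the SAME rate, no `e^{2ρ₀r}` —, then `e^{−ρ₀d₁} ≤ e^{−ρ₀D_□}` from a cube of the domain (§1);
the smallness is `λ_K`'s (print: `O(M⁻¹)`). [cite: Balaban1985BackgroundPropagators, (3.42) p.399, (3.88)–(3.89) p.409, Cor 3.8 (3.91)–(3.94) p.410] -/
theorem isDomainLocalBD_step
    (hanchor : ∀ b, L.anchor b ∈ L.dom b) (hdiam : ∀ b, ∀ z ∈ L.dom b, ∀ z' ∈ L.dom b, tdist1 K z z' ≤ r)
    (hJ0 : ∀ b, L.J b = ∅) (hmult : ∀ z : UT K, (Finset.univ.filter fun b => L.anchor b = z).card ≤ nD)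
    (hsupp : ∀ b y, y ∉ Es b → h b y = 0) (habs : ∀ b y, |h b y| ≤ 1) (hE : ∀ b y, y ∈ Es b → cubn y ∈ L.dom b)
    (hLan : ∀ b i j, DifferentiableOn ℂ (fun u => L.op b u i j) (ball (0 : E) R))
    (hLbdD : ∀ b, ∀ u ∈ ball (0 : E) R, ∀ y y',
      blockNorm cubn cubn (L.op b u) y y' ≤ CL * Real.exp (-(ρ₀ * tdist1 K y y')))
    (hCL : 0 ≤ CL) (hρ₀ : 0 ≤ ρ₀)
    (hKan : ∀ i j, DifferentiableOn ℂ (fun u => K' u i j) (ball (0 : E) R))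
    (hKbdD : ∀ b, ∀ u ∈ ball (0 : E) R, ∀ y y'',
      blockNorm cubn cubn (Hd h b * K' u - K' u * Hd h b) y y'' ≤ lamK * Real.exp (-(ρ₀ * tdist1 K y y'')))
    (hlamK : 0 ≤ lamK)
    (hKsupp : ∀ b u y y', blockNorm cubn cubn (Hd h b * K' u - K' u * Hd h b) y y' ≠ 0 → y ∈ L.dom b ∧ y' ∈ L.dom b)
    (hcard : ∀ b, (L.dom b).card ≤ nC) :
    IsDomainLocalBD (withOp L fun b u => (Hd h b * K' u - K' u * Hd h b) * L.op b u * Hd h b) c₀ cubn cubn ∅ R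
      (nC * lamK * CL) ρ₀ r 0 nD := by
  have hsuppB : ∀ b u y y', blockNorm cubn cubn ((Hd h b * K' u - K' u * Hd h b) * L.op b u * Hd h b) y y' ≠ 0 →
      y ∈ L.dom b ∧ y' ∈ L.dom b := by
    intro b u y y' hne
    refine ⟨?_, ?_⟩
    · by_contra hy
      apply hne
      rw [Matrix.mul_assoc]
      refine blockNorm_mul_eq_zero_of_left cubn cubn cubn _ _ y y' (fun y'' => ?_)
      by_contra h0
      exact hy (hKsupp b u y y'' h0).1
    · by_contra hy'
      apply hne
      exact blockNorm_mul_diagonal_eq_zero cubn cubn ((Hd h b * K' u - K' u * Hd h b) * L.op b u) y y'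
        (fun j hj => h_eq_zero hsupp hE b hy' j hj)
  exact
  { hanchor := hanchor
    hsuppB := hsuppB
    han := fun b i j => by
      change DifferentiableOn ℂ (fun u => ((Hd h b * K' u - K' u * Hd h b) * L.op b u * Hd h b) i j) (ball (0 : E) R)
      have hcomm : ∀ i k, DifferentiableOn ℂ (fun u => (Hd h b * K' u - K' u * Hd h b) i k) (ball (0 : E) R) := by
        intro i k
        simp only [Hd, Matrix.sub_apply, Matrix.mul_diagonal, Matrix.diagonal_mul]
        exact ((differentiableOn_const _).mul (hKan i k)).sub ((hKan i k).mul (differentiableOn_const _))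
      have h2 := differentiableOn_mul_apply (S := fun u => (Hd h b * K' u - K' u * Hd h b)) (T := fun u => L.op b u)
        hcomm (hLan b)
      simp only [Hd, Matrix.mul_diagonal]
      exact (h2 i j).mul (differentiableOn_const _)
    hbdBD := fun b u hu y y' => by
      change blockNorm cubn cubn ((Hd h b * K' u - K' u * Hd h b) * L.op b u * Hd h b) y y' ≤
        nC * lamK * CL * Real.exp (-(ρ₀ * (withOp L fun b u => (Hd h b * K' u - K' u * Hd h b) * L.op b u * Hd h b).dist ∅ b y y'))
      by_cases h0 : blockNorm cubn cubn ((Hd h b * K' u - K' u * Hd h b) * L.op b u * Hd h b) y y' = 0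
      · rw [h0]; positivity
      have hy : y ∈ L.dom b := (hsuppB b u y y' h0).1
      classical
      have hstep1 : blockNorm cubn cubn ((Hd h b * K' u - K' u * Hd h b) * L.op b u * Hd h b) y y' ≤
          blockNorm cubn cubn ((Hd h b * K' u - K' u * Hd h b) * L.op b u) y y' :=
        blockNorm_mul_diagonal_le cubn cubn _ (norm_h_le habs b) y y'
      have hstep2 : blockNorm cubn cubn ((Hd h b * K' u - K' u * Hd h b) * L.op b u) y y' ≤
          ∑ y'' : UT K, blockNorm cubn cubn (Hd h b * K' u - K' u * Hd h b) y y'' * blockNorm cubn cubn (L.op b u) y'' y' :=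
        blockNorm_mul_le cubn cubn cubn _ _ y y'
      -- the triangle inequality absorbs the middle cube: each summand ≤ λ_KC_L·e^{−ρ₀d₁(y,y′)}, and vanishes off the domain
      have htri : ∀ y'', Real.exp (-(ρ₀ * tdist1 K y y'')) * Real.exp (-(ρ₀ * tdist1 K y'' y')) ≤
          Real.exp (-(ρ₀ * tdist1 K y y')) := by
        intro y''
        rw [← Real.exp_add]
        exact Real.exp_le_exp.2 (by have := tdist1_triangle (N := K) y y'' y'; nlinarith)
      have hterm : ∀ y'', blockNorm cubn cubn (Hd h b * K' u - K' u * Hd h b) y y'' * blockNorm cubn cubn (L.op b u) y'' y' ≤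
          if y'' ∈ L.dom b then lamK * CL * Real.exp (-(ρ₀ * tdist1 K y y')) else 0 := by
        intro y''
        split_ifs with hy''
        · calc blockNorm cubn cubn (Hd h b * K' u - K' u * Hd h b) y y'' * blockNorm cubn cubn (L.op b u) y'' y'
              ≤ (lamK * Real.exp (-(ρ₀ * tdist1 K y y''))) * (CL * Real.exp (-(ρ₀ * tdist1 K y'' y'))) :=
                mul_le_mul (hKbdD b u hu y y'') (hLbdD b u hu y'' y') (blockNorm_nonneg _ _ _ _ _) (by positivity)
            _ = lamK * CL * (Real.exp (-(ρ₀ * tdist1 K y y'')) * Real.exp (-(ρ₀ * tdist1 K y'' y'))) := by ring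
            _ ≤ lamK * CL * Real.exp (-(ρ₀ * tdist1 K y y')) :=
                mul_le_mul_of_nonneg_left (htri y'') (mul_nonneg hlamK hCL)
        · have h0 : blockNorm cubn cubn (Hd h b * K' u - K' u * Hd h b) y y'' = 0 := by
            by_contra h0; exact hy'' (hKsupp b u y y'' h0).2
          rw [h0, zero_mul]
      have hstep3 : ∑ y'' : UT K, blockNorm cubn cubn (Hd h b * K' u - K' u * Hd h b) y y'' *
          blockNorm cubn cubn (L.op b u) y'' y' ≤ (L.dom b).card * (lamK * CL * Real.exp (-(ρ₀ * tdist1 K y y'))) := by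
        calc ∑ y'' : UT K, blockNorm cubn cubn (Hd h b * K' u - K' u * Hd h b) y y'' * blockNorm cubn cubn (L.op b u) y'' y'
            ≤ ∑ y'' : UT K, (if y'' ∈ L.dom b then lamK * CL * Real.exp (-(ρ₀ * tdist1 K y y')) else 0) :=
              Finset.sum_le_sum fun y'' _ => hterm y''
          _ = (L.dom b).card * (lamK * CL * Real.exp (-(ρ₀ * tdist1 K y y'))) := by
              rw [Finset.sum_ite_mem, Finset.univ_inter, Finset.sum_const, nsmul_eq_mul]
      have hstep4 : ((L.dom b).card : ℝ) * (lamK * CL * Real.exp (-(ρ₀ * tdist1 K y y'))) ≤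
          nC * (lamK * CL * Real.exp (-(ρ₀ * tdist1 K y y'))) :=
        mul_le_mul_of_nonneg_right (by exact_mod_cast hcard b) (by positivity)
      calc _ ≤ _ := hstep1
        _ ≤ _ := hstep2
        _ ≤ _ := hstep3
        _ ≤ _ := hstep4
        _ = nC * lamK * CL * Real.exp (-(ρ₀ * tdist1 K y y')) := by ring
        _ ≤ _ := mul_exp_tdist1_le_dist (withOp L fun b u => (Hd h b * K' u - K' u * Hd h b) * L.op b u * Hd h b) b hy y'
            (by positivity) hρ₀
    hdiam := hdiam
    hJ := fun b => by change (L.J b).card ≤ 0; rw [hJ0 b, Finset.card_empty]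
    hX := fun b hb => by
      exfalso
      have h1 : (L.J b).Nonempty := hb
      rw [hJ0 b] at h1
      exact Finset.not_nonempty_empty h1
    hmult := hmult }

/-! ## §3. THE END: Theorem 3.10 at one scale in print's bookkeeping, FROM THEOREM 3.7's INPUT LETTERS -/

/-- **THEOREM 3.10 AT ONE SCALE, PRINT'S BOOKKEEPING, FROM THEOREM 3.7's INPUTS (block currency, decaying letters).**  A domain
skeleton with untagged terms (`J ≡ ∅`) carrying local inverses `G′_□(u)` with the DECAYING block letter `(C_L, ρ₀)` on the
`R`-ball (holomorphic entries), a partition `{h_□}` (`|h_□| ≤ 1`, supports inside the domains), commutators `K(h_□)(u)` with the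
decaying block letter `(λ_K, ρ₀)` and blocks inside the domains, `#dom □ ≤ n_C`, geometry `(r, n_D)`, the cube row sum `(μ, c_μ)`,
rates `0 ≤ μ`, `3μ ≤ ε₀`, `2μ ≤ κ₀`, `κ₀ + μ ≤ ρ₀ − ε₀`, the Neumann MARGIN `q = c_μ(c_μ·1·(1·(n_Cλ_KC_L·e^{κ₁·0})e^{μr}n_Dc_μ)c_μ)c_μ < 1`
— `O(λ_K) = O(M⁻¹)` at fixed cube geometry, NEITHER `e^{κ₁m_J}` NOR `e^{2ρ₀r}` — and print's decoration data (parameter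
cells `cellOf`, `J′_□ ⊂ cellOf(dom □)`, packing number `P` per `R_b`-ball, `r₀ + r ≤ R_b`, shift `κ₁P∕r₀ ≤ ε₀ − 3μ`) ⟹ the
s-DECORATED glued family is a `BlockWalkExpansion` at `(ε₀ − 3μ − κ₁P∕r₀, κ₀ − 2μ)` with an explicit torus-free constant, whose
kernel at `s ≡ 1` is `S(u)·(1 − R(u))⁻¹` — by files 44 ∘ §2 BY NAME.
[cite: Balaban1988RG2Cluster, p.3, (1.11) p.5, p.13, p.15, (2.16) p.16; Balaban1985BackgroundPropagators, (3.42) p.399, Thm 3.7 (3.87)–(3.90) p.409, Cor 3.8 p.410, Thm 3.10 (3.107)–(3.108) p.416] -/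
theorem blockWalkExpansion_print_parametrix
    (hanchor : ∀ b, L.anchor b ∈ L.dom b) (hdiam : ∀ b, ∀ z ∈ L.dom b, ∀ z' ∈ L.dom b, tdist1 K z z' ≤ r)
    (hJ0 : ∀ b, L.J b = ∅) (hmult : ∀ z : UT K, (Finset.univ.filter fun b => L.anchor b = z).card ≤ nD)
    (hsupp : ∀ b y, y ∉ Es b → h b y = 0) (habs : ∀ b y, |h b y| ≤ 1) (hE : ∀ b y, y ∈ Es b → cubn y ∈ L.dom b)
    (hLan : ∀ b i j, DifferentiableOn ℂ (fun u => L.op b u i j) (ball (0 : E) R))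
    (hLbdD : ∀ b, ∀ u ∈ ball (0 : E) R, ∀ y y',
      blockNorm cubn cubn (L.op b u) y y' ≤ CL * Real.exp (-(ρ₀ * tdist1 K y y')))
    (hCL : 0 ≤ CL)
    (hKan : ∀ i j, DifferentiableOn ℂ (fun u => K' u i j) (ball (0 : E) R))
    (hKbdD : ∀ b, ∀ u ∈ ball (0 : E) R, ∀ y y'',
      blockNorm cubn cubn (Hd h b * K' u - K' u * Hd h b) y y'' ≤ lamK * Real.exp (-(ρ₀ * tdist1 K y y'')))
    (hlamK : 0 ≤ lamK)
    (hKsupp : ∀ b u y y', blockNorm cubn cubn (Hd h b * K' u - K' u * Hd h b) y y' ≠ 0 → y ∈ L.dom b ∧ y' ∈ L.dom b)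
    (hcard : ∀ b, (L.dom b).card ≤ nC)
    (hκ₁₀ : 0 ≤ c₀.κ₁) (hr : 0 ≤ r) (hμ : 0 ≤ μ) (hμε : 3 * μ ≤ ε₀) (hμκ : 2 * μ ≤ κ₀) (hwin : κ₀ + μ ≤ ρ₀ - ε₀)
    (hcμ : 0 ≤ cμ) (hrow : RowSum (toB6 (torusGeom K 0 0 0) 0 True) μ cμ)
    (hq : cμ * (cμ * 1 * (1 * (((nC * lamK * CL) * Real.exp (c₀.κ₁ * (0 : ℕ))) * Real.exp (μ * r) * (nD * cμ))) * cμ) *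
      cμ < 1)
    (cellOf : UT K → TPt d N') (J' : L.B → Finset (TPt d N')) (hJ' : ∀ b, J' b ⊆ (L.dom b).image cellOf)
    (hJ'X : ∀ b, (J' b).Nonempty → (L.dom b ∩ X).Nonempty) {P : ℕ} {r₀ Rb : ℝ} (hr₀ : 0 < r₀) (hRD : r₀ + r ≤ Rb)
    (hpack : ∀ a : UT K, ∃ S : Finset (TPt d N'), S.card ≤ P ∧ ∀ z, tdist1 K a z ≤ Rb → cellOf z ∈ S)
    (hκ₁ : 0 ≤ c.κ₁) (hshift : c.κ₁ * (P / r₀) ≤ ε₀ - 3 * μ) :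
    ∃ (W : Type) (T : W → (TPt d N' → ℂ) → E → Matrix n n ℂ) (A : W → ℝ) (D : W → UT K → UT K → ℝ) (ρ' : ℝ)
      (dec : W → Finset (TPt d N')),
      BlockWalkExpansion c cubn cubn (decKernel T dec) X R (ε₀ - 3 * μ - c.κ₁ * (P / r₀)) (κ₀ - 2 * μ)
        (Real.exp (c.κ₁ * P) * (Real.exp ((ε₀ - 3 * μ) * (2 * r)) *
          (cμ * ((CL * Real.exp (c₀.κ₁ * (0 : ℕ))) * Real.exp (μ * r) * (nD * cμ)) *
            (1 * (1 - cμ * (cμ * 1 * (1 * (((nC * lamK * CL) * Real.exp (c₀.κ₁ * (0 : ℕ))) * Real.exp (μ * r) *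
              (nD * cμ))) * cμ) * cμ)⁻¹) * cμ)))
        (decTerm T dec) {w | (dec w).Nonempty} A D ρ' ∧
      (∀ u ∈ ball (0 : E) R, decKernel T dec (fun _ => 1) u =
        (withOp L fun b u => Hd h b * L.op b u * Hd h b).kernel (fun _ => 1) u *
          ((1 : Matrix n n ℂ) + (-1 : ℂ) •
            (withOp L fun b u => (Hd h b * K' u - K' u * Hd h b) * L.op b u * Hd h b).kernel (fun _ => 1) u)⁻¹) ∧
      ∀ ω, DomBy (toB6 (torusGeom K 0 0 0) 0 True) (D ω) :=
  have hρ₀ : 0 ≤ ρ₀ := by linarith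
  blockWalkExpansion_oneScale_print
    (isDomainLocalBD_seed hanchor hdiam hJ0 hmult hsupp habs hE hLan hLbdD hCL hρ₀)
    (isDomainLocalBD_step hanchor hdiam hJ0 hmult hsupp habs hE hLan hLbdD hCL hρ₀ hKan hKbdD hlamK hKsupp hcard)
    hκ₁₀ hCL (by positivity) hr hμ hμε hμκ hwin hcμ hrow hq cellOf J' hJ' hJ'X hr₀ hRD hpack hκ₁ hshift

/-- **… AND AT `s ≡ 1` THE DECORATED KERNEL IS `Δ′(u)⁻¹ = (1 + K′(u))⁻¹`**: with `Σ_□ h_□² = 1`, the local-inverse identities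
`P_□G′_□(u) = G′_□(u)`, `P_□(1 + K′(u))P_□G′_□(u) = P_□` and `1 − R(u)` invertible, (3.88) (file 33 §3, the prior engine's
resummation identity) identifies the `s ≡ 1` kernel of §3's expansion with `(1 + K′(u))⁻¹` on the ball: the s-decorated
expansion IS a random-walk expansion OF `Δ′(u)⁻¹`. [cite: Balaban1985BackgroundPropagators, (3.88)–(3.90) p.409, Thm 3.10 (3.108) p.416; Balaban1988RG2Cluster, p.3] -/
theorem decKernel_one_eq_inv {W : Type} {T : W → (TPt d N' → ℂ) → E → Matrix n n ℂ} {dec : W → Finset (TPt d N')}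
    (hker : ∀ u ∈ ball (0 : E) R, decKernel T dec (fun _ => 1) u =
      (withOp L fun b u => Hd h b * L.op b u * Hd h b).kernel (fun _ => 1) u *
        ((1 : Matrix n n ℂ) + (-1 : ℂ) •
          (withOp L fun b u => (Hd h b * K' u - K' u * Hd h b) * L.op b u * Hd h b).kernel (fun _ => 1) u)⁻¹)
    (hsum : ∀ y, ∑ b, h b y ^ 2 = 1) (hsupp : ∀ b y, y ∉ Es b → h b y = 0)
    (hPL : ∀ b, ∀ u ∈ ball (0 : E) R, Pj Es b * L.op b u = L.op b u)
    (hinv : ∀ b, ∀ u ∈ ball (0 : E) R, Pj Es b * (1 + K' u) * Pj Es b * L.op b u = Pj Es b)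
    (hunit : ∀ u ∈ ball (0 : E) R, IsUnit
      (1 - (withOp L fun b u => (Hd h b * K' u - K' u * Hd h b) * L.op b u * Hd h b).kernel (fun _ => (1 : ℂ)) u).det) :
    ∀ u ∈ ball (0 : E) R, decKernel T dec (fun _ => 1) u = (1 + K' u)⁻¹ := fun u hu => by
  rw [hker u hu]
  exact glued_one_eq_inv L h Es K' u hsum hsupp (fun b => hPL b u hu) (fun b => hinv b u hu) (hunit u hu)

end Summit.QuantumFields.BalabanUV.Gaps.D4WalkBlockParametrixDecay

end
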